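import Summits.ABC.IUTFork.ForkRegions
import Summits.ABC.IUTFork.Cor312Containers
import HarnessLib

/-!
# The fork at [IUTchIII] Corollary 3.12 — the Corollary's setting over the REAL tensor-packet declarations,
# and the bridge between the verbatim form and the Dupuy–Hilado form

Record-only file (D-0012) of the abc-iut cell (Cor. 3.12 sub-crew, wave 2, seat abc-iut-c312-6, board row W2-C);
TAKES NO SIDE. `ForkRegions` (XVII) states Corollary 3.12 one level below the reals over the INTERFACE
`VolumeContainer` / `Cor312Setting` and proves there what follows formally (`logvol_U_le_negLogTheta`, the three
readings of Step (xi) with `RepresentedVol → Cor312`, `QSubHull → Cor312`, `readings_differ`, `cor312_iff_inflation`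
in XVIII). `Cor312Containers` supplies the interface's fields from the declarations landed for the nouns the
Corollary quotes. THIS file assembles them:

* §1 `packetContainerE` — ONE tensor packet `𝓘^ℚ(^{S^±_{j+1}}𝓕_{v_ℚ})` as a `VolumeContainer`: carrier `M_V = Π_{v⃗} M_{v⃗}`
  ([IUTchIII] Rmk. 3.1.1 (iii): `V = Π_α 𝕍_{v_ℚ}`, `M_v` = the [radial] summand), admissible = finite nonzero
  `E`-weighted measure, `ln ν̄ = (1/(N_E·D))·log μ_E` (Rmk. 3.1.1 (iv); Prop. 3.9 (i)), hull = a closure operator on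
  the packet (S2's `hullClosureOperator` when the packet is presented as `Π K_v`; = L6-t4's hull of Rmk. 3.9.5 (i)
  by `Cor312Vol.holomorphicHull_eq_logVolume`); `LocalFamily.assemble` — the product over `t = (j, v_ℚ) ∈ 𝔽_l^⋇ × 𝕍_ℚ`
  of local containers with weights `c_t` (boxes, `aggLogvol`, `boxHull`): `logvol_mono` PROVED, no field posited.
* §2 `verbatimSetting` — the `Cor312Setting` whose possible images `U_λ` and `q`-image `Q` are PARAMETERS (they are
  c312-7's `Cor312Statement` objects: Def. 3.8 (i) `thetaPilotObject`/`qPilotObject` through Thm. 3.11 (i)(ii) and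
  (Ind1)(Ind2)(Ind3)); `negLogTheta_eq` unfolds `−|log(Θ)|` to `Σᶠ_t c_t · ln ν̄_t(hull_t(pr_t ⋃_λ U_λ))` — with
  `Cor312Vol.aggLogvol_pi_eq_processionNormalized` this is L6-t4's `processionNormalized (globalLogVolume …)` of the
  packet hulls, i.e. the printed "procession-normalized mono-analytic log-volume of the holomorphic hull of the
  union of the possible images" BY NAME; every skeleton theorem of XVII/XVIII now applies to these real nouns.
* §3 BRIDGE lemmas: two settings with the same two numbers have the same `Cor312` (`cor312_iff_of_eq`); a
  volume-preserving correspondence of possible images transports `RepresentedVol`. This is the shape of the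
  bridge verbatim form (c312-7, over this file) ↔ Dupuy–Hilado form (c312-3 `DHData.toSetting`, `Cor312DH`):
  `VerbatimDHAgreement` names the two identifications it takes (hull log-volume, `q`-image log-volume) and
  `cor312_iff_of_agreement` is the bridge modulo them. WHY the local normalisations agree summand-by-summand is
  PROVED arithmetic: `verbatim_weight_eq_dh_weight` — Mochizuki's normalized weight
  `1/((Π_α [K_{v_α}:(F_mod)_{v_α}])·(Σ_w [(F_mod)_w:ℚ_p])^{#A})` (Rmk. 3.1.1 (ii), L6-t4 `packetWeightTensor`) times
  `log μ` equals Dupuy–Hilado's `Π_α Pr(v_α) · log μ / dim_{ℚ_p}` (§3.4, §3.6) with `Pr(v) = [F_v:ℚ_p]/[F:ℚ]`,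
  `dim = Π_α [K_{v_α}:ℚ_p]`. What is NOT identified here (residual, named): IUT sums over the section `𝕍 ≅ 𝕍_mod`
  while DH average over all places of their field — equal only for Galois-symmetric regions; archimedean `v_ℚ`
  (absent from DH's `ln ν̄_𝕃` over primes `p ∈ T`).

Sources read on the page: [IUTchIII] kurims `paper:url-4b091feeb646` pp. 93–97, 115–117, 126–127, 173–174;
Dupuy–Hilado arXiv:2004.13228 §1 pp. 3–4, §3.4–3.6. [claim: Mochizuki2012, status: disputed]
[cite: DupuyHilado2025, §1 pp. 3–4, §3.4, §3.6]
Deliberately NOT here: the possible images themselves (c312-7/c312-1), the DH data (c312-3), c312-2's `Volumes`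
(its `Volumes.ofSetting` consumes any `Cor312Setting`, in particular `verbatimSetting`), any judgement.
-/

noncomputable section

open Set MeasureTheory
open scoped ENNReal

namespace Summit.ABC

namespace IUTFork

namespace Cor312Vol

/-! ## 1. Real volume containers: one tensor packet; the product over labels and places -/

section Packet

open Literature.IUT.LogThetaLattice

variable {V : Type} [Fintype V] [DecidableEq V] (E : V → Type) [∀ v, Fintype (E v)] [∀ v, Nonempty (E v)]
variable (M : V → Type) [∀ v, MeasurableSpace (M v)] (μ : ∀ v, Measure (M v))

/-- **One tensor packet as a volume container** (VERBATIM side): carrier `M_V = Π_{v∈V} M_v` ([IUTchIII]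
Rmk. 3.1.1 (iii) p. 95–96: `V = Π_α 𝕍_{v_ℚ}`, `M_v` the [radial] summand indexed by `v = {v_α}`), admissible regions =
Borel sets of finite nonzero `E`-weighted measure, `ln ν̄ := (1/(N_E·D))·log μ_E` (Rmk. 3.1.1 (iv) p. 97; Prop. 3.9 (i)
p. 115), hull = a closure operator on the packet (Rmk. 3.9.5 (i); S2's `hullClosureOperator` in the norm
presentation). `logvol_mono` is the PROVED `packetLogvolE_mono`. [claim: Mochizuki2012, status: disputed] -/
abbrev packetContainerE (D : ℝ) (hD : 0 < D) (hull : ClosureOperator (Set (∀ v, M v))) : VolumeContainer where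
  L := ∀ v, M v
  Adm := Adm (weightedMeasure E M μ)
  logvol := packetLogvolE E M μ D
  logvol_mono := fun _ _ hA hB hAB => packetLogvolE_mono E M μ hD hA hB hAB
  hull := hull

-- On direct product regions the log-volume of `packetContainerE` is L6-t4's `packetLogVolume` with the
-- normalized weights: `Cor312Vol.packetLogvolE_directProduct` (landed), not restated here.

end Packet

/-- A FAMILY OF LOCAL VOLUME CONTAINERS indexed by `t` (for Cor. 3.12: `t = (j, v_ℚ) ∈ 𝔽_l^⋇ × 𝕍_ℚ`, one tensor
packet each) with nonnegative aggregation weights `c_t` (`1/l⋇`: [IUTchIII] Prop. 3.9 (i) "average over the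
capsules", (iii) "adding the log-volumes … at the various `v_ℚ`"). Parameter record. [claim: Mochizuki2012, status: disputed] -/
structure LocalFamily where
  /-- the index set of the packets -/
  T : Type
  /-- aggregation weights -/
  c : T → ℝ
  /-- they are nonnegative -/
  c_nonneg : ∀ t, 0 ≤ c t
  /-- the packet containers -/
  C : T → VolumeContainer

namespace LocalFamily

variable (P : LocalFamily)

/-- **The assembled volume container** `𝕃 = Π_t 𝕃_t` (Dupuy–Hilado §1: one "adelic" `𝕃`; [IUTchIII] Prop. 3.9 (iii):
global regions = families of local regions): admissible = boxes of admissible nonempty factors with finitely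
supported weighted log-volume, `ln ν̄ = Σᶠ_t c_t · ln ν̄_t(pr_t −)` (`Cor312Vol.aggLogvol`), hull = componentwise
(`Cor312Vol.boxHull`). `logvol_mono` is the PROVED `aggLogvol_mono`. [claim: Mochizuki2012, status: disputed] -/
abbrev assemble : VolumeContainer where
  L := ∀ t, (P.C t).L
  Adm := AggAdm (fun t => (P.C t).Adm) P.c (fun t => (P.C t).logvol)
  logvol := aggLogvol P.c (fun t => (P.C t).logvol)
  logvol_mono := fun _ _ hA hB hAB =>
    aggLogvol_mono P.c_nonneg (fun t _ _ hA hB hAB => (P.C t).logvol_mono hA hB hAB) hA hB hAB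
  hull := boxHull fun t => (P.C t).hull

/-- The assembled log-volume of a box with nonempty factors. [folklore] -/
theorem assemble_logvol_pi (S : ∀ t, Set (P.C t).L) (hS : ∀ t, (S t).Nonempty) :
    P.assemble.logvol (Set.univ.pi S) = ∑ᶠ t, P.c t * (P.C t).logvol (S t) :=
  aggLogvol_pi P.c _ S hS

/-- The assembled hull of any region is the box of the local hulls of its projections. [folklore] -/
theorem assemble_hull_apply (A : Set P.assemble.L) :
    P.assemble.hull A = Set.univ.pi fun t => (P.C t).hull ((fun x : P.assemble.L => x t) '' A) := rfl

end LocalFamily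

open Literature.IUT.LogThetaLattice in
/-- The weighted sum over `t = (j, v_ℚ)` with weights `1/l⋇` IS L6-t4's `processionNormalized` of the sums over
`v_ℚ` ([IUTchIII] Prop. 3.9 (i) "average over `j`", (iii) "adding … at the various `v_ℚ`") — the pure bookkeeping
behind `Cor312Vol.aggLogvol_pi_eq_processionNormalized`, for any finitely supported summand. [folklore] -/
theorem finsum_eq_processionNormalized {lstar : ℕ} {VQ : Type*} (f : Fin lstar × VQ → ℝ)
    (hfin : ∀ i, (Function.support fun vQ => f (i, vQ)).Finite) :
    ∑ᶠ t, (1 / (lstar : ℝ)) * f t = processionNormalized fun i => ∑ᶠ vQ, f (i, vQ) := by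
  rw [← mul_finsum]
  have hsupp : (Function.support f).Finite := by
    refine (Set.finite_iUnion fun i : Fin lstar => (hfin i).image fun vQ => (i, vQ)).subset ?_
    rintro ⟨i, vQ⟩ ht
    exact Set.mem_iUnion.mpr ⟨i, ⟨vQ, ht, rfl⟩⟩
  rw [finsum_curry f hsupp, finsum_eq_sum_of_fintype]
  unfold processionNormalized
  rw [one_div, inv_mul_eq_div]

/-- A support indexed by `𝔽_l^⋇ × 𝕍_ℚ` is finite as soon as each label's support over `𝕍_ℚ` is ([IUTchIII] Prop. 3.9
(iii): "all but finitely many of which are zero", per label). [folklore] -/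
theorem support_finite_of_labels {lstar : ℕ} {VQ : Type*} {f : Fin lstar × VQ → ℝ} (c : ℝ)
    (hfin : ∀ i, (Function.support fun vQ => f (i, vQ)).Finite) :
    (Function.support fun t => c * f t).Finite := by
  refine (Set.finite_iUnion fun i : Fin lstar => (hfin i).image fun vQ => (i, vQ)).subset ?_
  rintro ⟨i, vQ⟩ ht
  exact Set.mem_iUnion.mpr ⟨i, ⟨vQ, fun h0 => ht (by simp only [h0, mul_zero]), rfl⟩⟩

/-! ## 2. The Cor-3.12 setting over a real container, possible images and `q`-image as parameters -/

section Setting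

variable (P : LocalFamily)

/-- **The VERBATIM Cor-3.12 setting**: the assembled real container together with the possible images `U_λ` of the
Θ-pilot object and the image `Q` of the `q`-pilot object ([IUTchIII] Cor. 3.12 p. 173: "the union of the possible
images of a Θ-pilot object [cf. Definition 3.8, (i)], relative to the relevant Kummer isomorphisms [cf. Theorem
3.11, (ii)], in the multiradial representation of Theorem 3.11, (i), which we regard as subject to the
indeterminacies (Ind1), (Ind2), (Ind3)"; "the image of a `q`-pilot object … which we do not regard as subject to
the indeterminacies") — PARAMETERS here (their construction is c312-7's statement file over Def. 3.8 / Thm. 3.11),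
with their admissibility and the ONE datum the Corollary asserts, `−|log(Θ)| ∈ ℝ` (`Uhol_adm`).
[claim: Mochizuki2012, status: disputed] -/
abbrev verbatimSetting {Idx : Type} (U : Idx → Set P.assemble.L) (U_adm : ∀ i, P.assemble.Adm (U i))
    (Uhol_adm : P.assemble.Adm (P.assemble.hull (⋃ i, U i))) (Q : Set P.assemble.L)
    (Q_adm : P.assemble.Adm Q) : Cor312Setting where
  toVolumeContainer := P.assemble
  Idx := Idx
  U := U
  U_adm := U_adm
  Uhol_adm := Uhol_adm
  Q := Q
  Q_adm := Q_adm

variable {P} {Idx : Type} (U : Idx → Set P.assemble.L) (U_adm : ∀ i, P.assemble.Adm (U i))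
  (Uhol_adm : P.assemble.Adm (P.assemble.hull (⋃ i, U i))) (Q : Set P.assemble.L) (Q_adm : P.assemble.Adm Q)

/-- `U^{hol}` of the verbatim setting is the box of the packet hulls of the projections of `⋃_λ U_λ` (the hull is
formed packet by packet: Rmk. 3.9.5 (i) is a definition inside one `𝓘^ℚ((−))`; (vi) p. 130 `φ(P_B)` for a family).
[claim: Mochizuki2012, status: disputed] -/
theorem verbatimSetting_Uhol :
    (verbatimSetting P U U_adm Uhol_adm Q Q_adm).Uhol =
      Set.univ.pi fun t => (P.C t).hull ((fun x : P.assemble.L => x t) '' ⋃ i, U i) := rfl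

/-- **`−|log(Θ)|` unfolded**: if the packet hulls are nonempty, `−|log(Θ)| = Σᶠ_t c_t · ln ν̄_t(hull_t(pr_t ⋃_λ U_λ))`
— for `t = (j, v_ℚ)`, `c_t = 1/l⋇` this is `processionNormalized (j ↦ globalLogVolume (v_ℚ ↦ ln ν̄_{(j,v_ℚ)}) …)`
by `Cor312Vol.aggLogvol_pi_eq_processionNormalized`, the printed "procession-normalized mono-analytic log-volume
of the holomorphic hull of the union of the possible images". [claim: Mochizuki2012, status: disputed] -/
theorem verbatimSetting_negLogTheta
    (hne : ∀ t, ((P.C t).hull ((fun x : P.assemble.L => x t) '' ⋃ i, U i)).Nonempty) :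
    (verbatimSetting P U U_adm Uhol_adm Q Q_adm).negLogTheta =
      ∑ᶠ t, P.c t * (P.C t).logvol ((P.C t).hull ((fun x : P.assemble.L => x t) '' ⋃ i, U i)) :=
  aggLogvol_pi P.c _ _ hne

/-- `−|log(q)|` of the verbatim setting is the assembled log-volume of `Q`; for a box `Q = Π_t Q_t` with nonempty
factors, `Σᶠ_t c_t · ln ν̄_t(Q_t)`. [claim: Mochizuki2012, status: disputed] -/
theorem verbatimSetting_negAbsLogq_pi (Qt : ∀ t, Set (P.C t).L) (hQ : ∀ t, (Qt t).Nonempty)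
    (hQeq : Q = Set.univ.pi Qt) :
    (verbatimSetting P U U_adm Uhol_adm Q Q_adm).negAbsLogq = ∑ᶠ t, P.c t * (P.C t).logvol (Qt t) := by
  show P.assemble.logvol Q = _
  rw [hQeq]
  exact aggLogvol_pi P.c _ Qt hQ

/-- Every possible image has log-volume `≤ −|log(Θ)|` — the skeleton's `logvol_U_le_negLogTheta`, now a theorem
about real regions and the real hull (monotonicity of `ln ν̄` + extensivity of the hull). [folklore] -/
theorem verbatimSetting_logvol_U_le (i : Idx) :
    P.assemble.logvol (U i) ≤ (verbatimSetting P U U_adm Uhol_adm Q Q_adm).negLogTheta :=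
  (verbatimSetting P U U_adm Uhol_adm Q Q_adm).logvol_U_le_negLogTheta i

end Setting

/-! ## 3. Bridge lemmas: verbatim form ↔ Dupuy–Hilado form modulo named identifications -/

section Bridge

/-- Two Cor-3.12 settings with the same `−|log(Θ)|` and the same `−|log(q)|` have the same `Cor312`. [folklore] -/
theorem cor312_iff_of_eq (C₁ C₂ : Cor312Setting) (hΘ : C₁.negLogTheta = C₂.negLogTheta)
    (hq : C₁.negAbsLogq = C₂.negAbsLogq) : C₁.Cor312 ↔ C₂.Cor312 := by
  unfold Cor312Setting.Cor312
  rw [hΘ, hq]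

/-- A correspondence of possible images preserving log-volumes, with equal `q`-volumes, transports Reading 1
(`RepresentedVol`, LANA (9-1) at volume level) from one setting to another. [folklore] -/
theorem representedVol_of_map (C₁ C₂ : Cor312Setting) (f : C₁.Idx → C₂.Idx)
    (hf : ∀ i, C₂.logvol (C₂.U (f i)) = C₁.logvol (C₁.U i)) (hq : C₁.negAbsLogq = C₂.negAbsLogq)
    (h : C₁.RepresentedVol) : C₂.RepresentedVol := by
  obtain ⟨i, hi⟩ := h
  exact ⟨f i, by rw [hf, hi, hq]⟩

/-- **The named identifications of the verbatim ↔ Dupuy–Hilado bridge** (HYPOTHESIS structure, nothing asserted):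
the VERBATIM setting `Cv` (this file over [IUTchIII] Prop. 3.9 / Rmk. 3.9.5 / Def. 3.8) and a DH setting `Cd`
(c312-3 `DHData.toSetting`: `𝕃 = ⊔` summands, `ln ν̄_𝕃` of DH Def. 3.6.3, `U_Θ = Ind2(Ind1((O_𝕃(−P_Θ))^{Ind3}))`,
`Q = O_𝕃(−P_q)`) compute the same hull log-volume and the same `q`-image log-volume. Dupuy–Hilado §1 p. 3:
"`𝕃` … is abstractly isomorphic to a space that appears in [IUT3]"; what such an identification must absorb is
recorded in the module docstring (section vs. all places; archimedean `v_ℚ`). [cite: DupuyHilado2025, §1 pp. 3–4] -/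
structure VerbatimDHAgreement (Cv Cd : Cor312Setting) : Prop where
  /-- `ln ν̄(hull ⋃ U_λ)` (verbatim) `= ln ν̄_𝕃(hull(U_Θ))` (DH) -/
  hull_logvol : Cv.negLogTheta = Cd.negLogTheta
  /-- `ln ν̄(Q)` (verbatim) `= ln ν̄_𝕃(O_𝕃(−P_q))` (DH) -/
  q_logvol : Cv.negAbsLogq = Cd.negAbsLogq

/-- Non-vacuity (weak) of the agreement structure: every setting agrees with itself; agreement is symmetric and
transitive (so a chain verbatim ↔ real model ↔ DH composes). [folklore] -/
theorem VerbatimDHAgreement.refl (C : Cor312Setting) : VerbatimDHAgreement C C := ⟨rfl, rfl⟩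

/-- Symmetry of the agreement. [folklore] -/
theorem VerbatimDHAgreement.symm {C₁ C₂ : Cor312Setting} (h : VerbatimDHAgreement C₁ C₂) :
    VerbatimDHAgreement C₂ C₁ := ⟨h.hull_logvol.symm, h.q_logvol.symm⟩

/-- Transitivity of the agreement. [folklore] -/
theorem VerbatimDHAgreement.trans {C₁ C₂ C₃ : Cor312Setting} (h₁ : VerbatimDHAgreement C₁ C₂)
    (h₂ : VerbatimDHAgreement C₂ C₃) : VerbatimDHAgreement C₁ C₃ :=
  ⟨h₁.hull_logvol.trans h₂.hull_logvol, h₁.q_logvol.trans h₂.q_logvol⟩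

/-- **Verbatim `Cor312` ↔ DH `Cor312` modulo the named identifications** (c312-3 proves `Cd.Cor312 ↔ Cor312DH`
= Dupuy–Hilado (1.1) for its constructed setting; composing gives verbatim ↔ (1.1)). [cite: DupuyHilado2025, §1 (1.1)] -/
theorem cor312_iff_of_agreement {Cv Cd : Cor312Setting} (h : VerbatimDHAgreement Cv Cd) :
    Cv.Cor312 ↔ Cd.Cor312 :=
  cor312_iff_of_eq Cv Cd h.hull_logvol h.q_logvol

/-- **WHY the local normalisations agree** (PROVED arithmetic): at a summand indexed by `{v_α}_{α∈A}` over `v_ℚ = p`,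
Mochizuki's normalized weight `1/((Π_α [K_{v_α}:(F_mod)_{v_α}]) · (Σ_w [(F_mod)_w:ℚ_p])^{#A})` ([IUTchIII] Rmk. 3.1.1
(ii) p. 94 — L6-t4's `packetWeightTensor`, with `sum_prod_degF_eq_pow`) EQUALS Dupuy–Hilado's
`(Π_α Pr(v_α)) / dim_{ℚ_p}(⊗_α K_{v_α})` (§3.4 `log μ̄ = log μ/dim`, §3.6 weights `Pr(v) = [F_v:ℚ_p]/[F:ℚ]`), where
`dim = Π_α [K_{v_α}:(F_mod)_{v_α}]·[(F_mod)_{v_α}:ℚ_p]` and `[F:ℚ] = Σ_w [(F_mod)_w:ℚ_p]`: both multiply `log μ_{v⃗}`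
by the same number. Stated over abstract positive degrees `degF w = [(F_mod)_w:ℚ_p]`, `degKF w = [K_w:(F_mod)_w]`.
[folklore] -/
theorem verbatim_weight_eq_dh_weight {W A : Type*} [Fintype W] [Nonempty W] [Fintype A] [DecidableEq A]
    (degF degKF : W → ℕ+) (wA : A → W) :
    Literature.IUT.LogThetaLattice.packetWeightTensor degF degKF wA =
      (∏ a, ((degF (wA a) : ℝ) / ∑ w, (degF w : ℝ))) /
        ∏ a, ((degKF (wA a) : ℝ) * (degF (wA a) : ℝ)) := by
  have hS : (0 : ℝ) < ∑ w, (degF w : ℝ) :=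
    Finset.sum_pos (fun w _ => by exact_mod_cast (degF w).pos) Finset.univ_nonempty
  have hF : ∀ a, (0 : ℝ) < (degF (wA a) : ℝ) := fun a => by exact_mod_cast (degF (wA a)).pos
  have hK : ∀ a, (0 : ℝ) < (degKF (wA a) : ℝ) := fun a => by exact_mod_cast (degKF (wA a)).pos
  have hPF : (0 : ℝ) < ∏ a, (degF (wA a) : ℝ) := Finset.prod_pos fun a _ => hF a
  have hPK : (0 : ℝ) < ∏ a, (degKF (wA a) : ℝ) := Finset.prod_pos fun a _ => hK a
  unfold Literature.IUT.LogThetaLattice.packetWeightTensor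
  rw [Literature.IUT.LogThetaLattice.sum_prod_degF_eq_pow, Finset.prod_div_distrib, Finset.prod_const,
    Finset.card_univ, Finset.prod_mul_distrib]
  field_simp

end Bridge

/-! ## 4. Non-vacuity (ForkChecks style): a toy verbatim setting over `(ℝ, Lebesgue)` with both truth values -/

section Toy

open Literature.IUT.LogThetaLattice

/-- TOY PACKET: one summand `ℝ` with Lebesgue measure, trivial `E` (`N = 1`), `D = 1`, hull = identity — an honest
instance of `packetContainerE` (consistency witness for the construction; not an IUT object). [folklore] -/
abbrev toyPacket : VolumeContainer :=
  packetContainerE (V := Unit) (fun _ => Unit) (fun _ => ℝ) (fun _ => volume) 1 one_pos (ClosureOperator.id _)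

/-- TOY FAMILY: a single packet with weight `1`. [folklore] -/
abbrev toyFamily : LocalFamily where
  T := Unit
  c := fun _ => 1
  c_nonneg := fun _ => zero_le_one
  C := fun _ => toyPacket

/-- The interval `[a, b]` in the one summand of the toy packet, as a region of the packet. [folklore] -/
def toyInterval (a b : ℝ) : Set (Unit → ℝ) := Set.univ.pi fun _ : Unit => Set.Icc a b

/-- The box region of the assembled toy container over `[a, b]`. [folklore] -/
def toyBox (a b : ℝ) : Set (Unit → Unit → ℝ) := Set.univ.pi fun _ : Unit => toyInterval a b

/-- `[a, b]` is nonempty for `a ≤ b`. [folklore] -/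
theorem toyInterval_nonempty {a b : ℝ} (h : a ≤ b) : (toyInterval a b).Nonempty :=
  ⟨fun _ => a, Set.mem_univ_pi.mpr fun _ => ⟨le_rfl, h⟩⟩

/-- The `E`-weighted measure of the toy interval is finite and nonzero for `a < b`. [folklore] -/
theorem toyInterval_adm {a b : ℝ} (h : a < b) : toyPacket.Adm (toyInterval a b) := by
  show Adm (weightedMeasure (V := Unit) (fun _ => Unit) (fun _ => ℝ) (fun _ => volume)) (toyInterval a b)
  unfold toyInterval Adm
  rw [weightedMeasure_pi]
  simp only [Real.volume_Icc, Finset.univ_unique, Finset.prod_singleton]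
  exact ⟨pow_ne_zero _ ((ENNReal.ofReal_pos.mpr (sub_pos.mpr h)).ne'), ENNReal.pow_ne_top ENNReal.ofReal_ne_top⟩

/-- The toy packet log-volume of `[a, b]` is `log (b − a)` (`a < b`). [folklore] -/
theorem toyPacket_logvol {a b : ℝ} (h : a < b) : toyPacket.logvol (toyInterval a b) = Real.log (b - a) := by
  show packetLogvolE (V := Unit) (fun _ => Unit) (fun _ => ℝ) (fun _ => volume) 1 (toyInterval a b) = _
  unfold toyInterval
  rw [packetLogvolE_directProduct (V := Unit) (fun _ => Unit) (fun _ => ℝ) (fun _ => volume) 1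
    (fun _ => Set.Icc a b) (fun _ => by simp [Real.volume_Icc, h])
    (fun _ => by simp [Real.volume_Icc])]
  simp [packetLogVolume, Real.volume_Icc, ENNReal.toReal_ofReal (sub_pos.mpr h).le]

/-- The toy box is an admissible region of the assembled container (`a < b`). [folklore] -/
theorem toyBox_adm {a b : ℝ} (h : a < b) : toyFamily.assemble.Adm (toyBox a b) :=
  ⟨fun _ => toyInterval a b, rfl, fun _ => ⟨toyInterval_nonempty h.le, toyInterval_adm h⟩,
    Set.toFinite (Function.support fun _ : Unit => (1 : ℝ) * toyPacket.logvol (toyInterval a b))⟩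

/-- The assembled log-volume of the toy box is `log (b − a)` (`a < b`). [folklore] -/
theorem toyFamily_logvol {a b : ℝ} (h : a < b) :
    toyFamily.assemble.logvol (toyBox a b) = Real.log (b - a) := by
  have h' : toyFamily.assemble.logvol (toyBox a b) =
      ∑ᶠ t, toyFamily.c t * (toyFamily.C t).logvol (toyInterval a b) :=
    toyFamily.assemble_logvol_pi (fun _ => toyInterval a b) (fun _ => toyInterval_nonempty h.le)
  rw [h', finsum_eq_sum_of_fintype, Fintype.sum_unique]
  exact (one_mul _).trans (toyPacket_logvol h)

/-- The assembled hull (box of identity hulls) of the single possible image `toyBox 0 1` is `toyBox 0 1`. [folklore] -/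
theorem toyFamily_hull_box : toyFamily.assemble.hull (⋃ _ : Unit, toyBox 0 1) = toyBox 0 1 := by
  rw [Set.iUnion_const]
  show boxHull (fun _ : Unit => ClosureOperator.id (Set (Unit → ℝ)))
      (Set.univ.pi fun _ : Unit => toyInterval 0 1) = toyBox 0 1
  rw [boxHull_pi _ _ (fun _ => toyInterval_nonempty zero_le_one)]
  rfl

/-- THE TOY VERBATIM SETTING with one possible image `toyBox 0 1` (log-volume `0`) and `q`-image `toyBox a b`.
[folklore] -/
def toySetting (a b : ℝ) (h : a < b) : Cor312Setting :=
  verbatimSetting toyFamily (fun _ : Unit => toyBox 0 1) (fun _ => toyBox_adm one_pos)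
    (by rw [toyFamily_hull_box]; exact toyBox_adm one_pos) (toyBox a b) (toyBox_adm h)

/-- In the toy setting `−|log(Θ)| = 0` and `−|log(q)| = log (b − a)`, so `Cor312 ↔ log (b − a) ≤ 0`. [folklore] -/
theorem toySetting_cor312_iff (a b : ℝ) (h : a < b) : (toySetting a b h).Cor312 ↔ Real.log (b - a) ≤ 0 := by
  show toyFamily.assemble.logvol (toyBox a b) ≤
    toyFamily.assemble.logvol (toyFamily.assemble.hull (⋃ _ : Unit, toyBox 0 1)) ↔ _
  rw [toyFamily_hull_box, toyFamily_logvol h, toyFamily_logvol one_pos, sub_zero, Real.log_one]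

/-- **NON-VACUITY / NON-TAUTOLOGY of the verbatim construction**: over the same real container, the Cor-3.12
inequality HOLDS for the `q`-image `[0, 1/2]` (`log ½ ≤ 0`) and FAILS for `[0, 2]` (`log 2 > 0`) — the assembled
container and `verbatimSetting` are consistent and `Cor312` over them is a genuine condition on the data
(cf. `ForkRegions.readings_differ`, `ForkChecks`). [folklore] -/
theorem toySetting_both_values :
    (toySetting 0 (1 / 2) (by norm_num)).Cor312 ∧ ¬ (toySetting 0 2 (by norm_num)).Cor312 := by
  refine ⟨(toySetting_cor312_iff _ _ _).mpr ?_, fun h => ?_⟩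
  · rw [sub_zero]; exact (Real.log_neg (by norm_num) (by norm_num)).le
  · have h2 := (toySetting_cor312_iff _ _ _).mp h
    rw [sub_zero] at h2
    exact absurd h2 (not_le.mpr (Real.log_pos (by norm_num)))

end Toy

end Cor312Vol

end IUTFork

end Summit.ABC

end
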